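import Literature.AlgebraicGeometry.ShimuraVarieties.UnitaryBallQuotientDatum
import Mathlib.NumberTheory.NumberField.CMField
import Mathlib.LinearAlgebra.FreeModule.IdealQuotient
import Mathlib.GroupTheory.OrderOfElement
import Mathlib.Analysis.Complex.Basic
import Mathlib.Analysis.Real.Sqrt
import Mathlib.Tactic.Module
import HarnessLib

/-!
# One elliptic–hyperbolic generator gives infinitely many `ι₁`-bounded elements of every `Γ_J(n)`

Topic `Literature/NumberTheory/Automorphic`, namespace `Literature.NumberTheory.Automorphic.UnitaryGroup`.  Cell `hodgecm-mathlib`,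
FLOOR 0, crux item stmt-HodgeConjecture-24832 (hLiu418), E-line socket `stub_SIG` (line L5), organ NOREC-A «a hermitian `J ∈ M₂(F)`
indefinite at TWO real places of `F⁺` has infinitely many `ι₁`-bounded elements in every principal congruence subgroup `Γ_J(n)`»
— this file is its RECORD-FREE, DIRICHLET-FREE TAIL: the passage from ONE good element to infinitely many.  THEOREMS ONLY.

THE MATHEMATICS ([PlatonovRapinchuk1994] §4.1 (congruence subgroups); the argument is folklore linear algebra).  Let `g ∈ U(J)(F⁺)`
be INTEGRAL (entries in `𝓞_F`) of determinant `1` with trace `t ∈ F⁺` (`c t = t`), ELLIPTIC at `ι₁` (`|ι₁ t| < 2`) and HYPERBOLIC at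
`σ` (`|σ t| > 2`).  Cayley–Hamilton `g² = t·g − 1` gives `g^k = x_k·1 + y_k·g` with `(x_{k+1}, y_{k+1}) = (−y_k, x_k + t y_k)` and the
INVARIANT `x_k² + t x_k y_k + y_k² = det g^k = 1`.  At `ι₁` (`s = ι₁ t ∈ ℝ`, `|s| < 2`) the form `x² + sxy + y²` is positive definite,
`4 = (2x + sy)² + (4 − s²)y²`, so `|x_k|, |y_k| ≤ 2/√(4 − s²)` and the `ι₁`-entries of every power of `g` are bounded by one constant.
At `σ` (`|σ t| > 2`) `|y_{k+1}| ≥ |σ t|·|y_k| − |x_k| > |y_k|`, so `y_k ≠ 0` for `k ≥ 1`; were `g^k = 1` then `g^σ` would be a scalar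
`c` with `c + c⁻¹ = σ t` and `c^k = 1`, `|σ t| ≤ 2` — so `g` has infinite order and its powers are pairwise distinct.  Finally `𝓞_F/(n)`
is finite, so the image of `g` in `GL₂(𝓞_F/(n))` has finite order `o`: `g^{o}` and `(g^{o})⁻¹ = (adj g)^{o}` are `≡ 1 (mod n)`
integrally, and `{g^{ok} : k ∈ ℕ} ⊆ Γ_J(n)` is an infinite `ι₁`-bounded family.

WHAT IS PROVED.
* (private) `mul_self_eq_trace_smul_sub_det_smul` — Cayley–Hamilton for `2 × 2` matrices over any commutative ring.
* (private) `exists_forall_pow_norm_apply_le_of_mul_self` — elliptic case: `B² = s·B − 1`, `s ∈ ℝ`, `|s| < 2` ⇒ the entries of all powers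
  `B^k` are bounded by one constant.
* (private) `pow_ne_one_of_mul_self` — hyperbolic case: `S² = s·S − 1`, `‖s‖ > 2` ⇒ `S^k ≠ 1` for `k ≠ 0`.
* `exists_pow_isCongruentOneMod` — an integral `2 × 2` matrix of determinant `1` over `𝓞_F` has a positive power `≡ 1 (mod n)`
  integrally together with the same power of its adjugate (★ `IsCongruentOneMod`).
* `infinite_setOf_mem_principalCongruenceSubgroup_norm_le_of_generator` — THE ORGAN: one integral elliptic-at-`ι₁`,
  hyperbolic-at-`σ` element of `U(J)` of determinant `1` yields, for every `n ≠ 0`, a bound `C` with INFINITELY many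
  `γ ∈ Γ_J(n)` (★ `principalCongruenceSubgroup`) all of whose entries have `ι₁`-norm `≤ C`.
NOT HERE: the EXISTENCE of such a generator (Dirichlet's unit theorem in the quadratic order `𝓞_{F⁺}[g]`, the head of NOREC-A,
LA5-p01), and anything about records.  HC_CM is proved only modulo the printed citations until rung 0 closes; no named fact here.
-/

set_option autoImplicit false

noncomputable section

open NumberField Matrix
open scoped Matrix ComplexOrder ComplexConjugate
open Literature.AlgebraicGeometry.ShimuraVarieties

namespace Literature.NumberTheory.Automorphic.UnitaryGroup

/-! ### §1 Cayley–Hamilton for `2 × 2` matrices -/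

/-- **Cayley–Hamilton, `2 × 2`**: `A·A = (tr A)·A − (det A)·1` (the `ℝ`-case is ★
`Literature.NumberTheory.Automorphic.mul_self_eq_trace_smul_sub_det_smul` of `ShimuraCurveFiniteVolume`; here any commutative
ring, kept private). [folklore] -/
private theorem mul_self_eq_trace_smul_sub_det_smul {R : Type*} [CommRing R] (A : Matrix (Fin 2) (Fin 2) R) :
    A * A = A.trace • A - A.det • (1 : Matrix (Fin 2) (Fin 2) R) := by
  ext i j
  fin_cases i <;> fin_cases j <;>
    simp [Matrix.mul_apply, Fin.sum_univ_two, Matrix.trace_fin_two, Matrix.det_fin_two] <;> ring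

/-! ### §2 The elliptic place: bounded powers -/

/-- **Elliptic powers are bounded**: if `B² = s·B − 1` with `s` REAL and `|s| < 2` (a `2 × 2` complex matrix of determinant `1`
with real trace of absolute value `< 2`, e.g. the `ι₁`-image of an elliptic element), then all entries of all powers `B^k` are
bounded by one constant — `B^k = x·1 + y·B` with the invariant `x² + sxy + y² = 1`, a positive definite form. [folklore] -/
private theorem exists_forall_pow_norm_apply_le_of_mul_self (B : Matrix (Fin 2) (Fin 2) ℂ) (s : ℝ) (hs : |s| < 2)
    (hB : B * B = (s : ℂ) • B - 1) : ∃ C : ℝ, ∀ (k : ℕ) (i j : Fin 2), ‖(B ^ k) i j‖ ≤ C := by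
  -- the invariant representation of the powers
  have key : ∀ k : ℕ, ∃ x y : ℝ, B ^ k = (x : ℂ) • (1 : Matrix (Fin 2) (Fin 2) ℂ) + (y : ℂ) • B ∧
      x ^ 2 + s * x * y + y ^ 2 = 1 := by
    intro k
    induction k with
    | zero => exact ⟨1, 0, by simp, by ring⟩
    | succ k ih =>
      obtain ⟨x, y, hk, hq⟩ := ih
      refine ⟨-y, x + s * y, ?_, by linear_combination hq⟩
      rw [pow_succ, hk, add_mul, smul_mul_assoc, smul_mul_assoc, one_mul, hB, smul_sub, smul_smul]
      push_cast
      module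
  -- the bound on the coordinates
  have h4 : 0 < 4 - s ^ 2 := by
    have : s ^ 2 < 2 ^ 2 := by
      rw [← sq_abs]
      exact pow_lt_pow_left₀ hs (abs_nonneg s) two_ne_zero
    linarith
  set M : ℝ := Real.sqrt (4 / (4 - s ^ 2)) with hM
  have hcoord : ∀ x y : ℝ, x ^ 2 + s * x * y + y ^ 2 = 1 → |x| ≤ M ∧ |y| ≤ M := by
    intro x y hq
    have hy : (4 - s ^ 2) * y ^ 2 ≤ 4 := by nlinarith [sq_nonneg (2 * x + s * y)]
    have hx : (4 - s ^ 2) * x ^ 2 ≤ 4 := by nlinarith [sq_nonneg (2 * y + s * x)]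
    refine ⟨Real.abs_le_sqrt ?_, Real.abs_le_sqrt ?_⟩
    · rw [le_div_iff₀ h4]; linarith
    · rw [le_div_iff₀ h4]; linarith
  -- the bound on the entries
  refine ⟨M + M * ∑ i, ∑ j, ‖B i j‖, fun k i j => ?_⟩
  obtain ⟨x, y, hk, hq⟩ := key k
  obtain ⟨hxM, hyM⟩ := hcoord x y hq
  have hM0 : 0 ≤ M := Real.sqrt_nonneg _
  have hBij : ‖B i j‖ ≤ ∑ i, ∑ j, ‖B i j‖ :=
    (Finset.single_le_sum (fun j _ => norm_nonneg (B i j)) (Finset.mem_univ j)).trans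
      (Finset.single_le_sum (f := fun i => ∑ j, ‖B i j‖) (fun i _ => Finset.sum_nonneg fun j _ => norm_nonneg (B i j))
        (Finset.mem_univ i))
  have hone : ‖(1 : Matrix (Fin 2) (Fin 2) ℂ) i j‖ ≤ 1 := by
    rw [Matrix.one_apply]
    split_ifs <;> simp
  rw [hk, Matrix.add_apply, Matrix.smul_apply, Matrix.smul_apply, smul_eq_mul, smul_eq_mul]
  calc ‖(x : ℂ) * (1 : Matrix (Fin 2) (Fin 2) ℂ) i j + (y : ℂ) * B i j‖
      ≤ ‖(x : ℂ) * (1 : Matrix (Fin 2) (Fin 2) ℂ) i j‖ + ‖(y : ℂ) * B i j‖ := norm_add_le _ _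
    _ = |x| * ‖(1 : Matrix (Fin 2) (Fin 2) ℂ) i j‖ + |y| * ‖B i j‖ := by
        rw [norm_mul, norm_mul, Complex.norm_real, Complex.norm_real, Real.norm_eq_abs, Real.norm_eq_abs]
    _ ≤ M * 1 + M * ∑ i, ∑ j, ‖B i j‖ := by
        gcongr
    _ = M + M * ∑ i, ∑ j, ‖B i j‖ := by rw [mul_one]

/-! ### §3 The hyperbolic place: infinite order -/

/-- **Hyperbolic elements have infinite order**: if `S² = s·S − 1` with `‖s‖ > 2` (e.g. the `σ`-image of an element of
determinant `1` whose trace has absolute value `> 2`), then `S^k ≠ 1` for every `k ≠ 0`: writing `S^k = x_k·1 + y_k·S`,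
`|y_k|` increases strictly, so `S^k = 1` would make `S` a scalar `c` with `c + c⁻¹ = s`, `c^k = 1`, `‖s‖ ≤ 2`. [folklore] -/
private theorem pow_ne_one_of_mul_self (S : Matrix (Fin 2) (Fin 2) ℂ) (s : ℂ) (hs : 2 < ‖s‖) (hS : S * S = s • S - 1)
    {k : ℕ} (hk : k ≠ 0) : S ^ k ≠ 1 := by
  -- the coordinates of the powers along `(1, S)`
  let v : ℕ → ℂ × ℂ := fun k => Nat.rec ((1 : ℂ), (0 : ℂ)) (fun _ p => (-p.2, p.1 + s * p.2)) k
  have hv0 : v 0 = (1, 0) := rfl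
  have hvs : ∀ k, v (k + 1) = (-(v k).2, (v k).1 + s * (v k).2) := fun k => rfl
  have hpow : ∀ k, S ^ k = (v k).1 • (1 : Matrix (Fin 2) (Fin 2) ℂ) + (v k).2 • S := by
    intro k
    induction k with
    | zero => simp [hv0]
    | succ k ih =>
      rw [pow_succ, ih, hvs, add_mul, smul_mul_assoc, smul_mul_assoc, one_mul, hS, smul_sub, smul_smul]
      module
  -- strict growth of the second coordinate
  have hgrow : ∀ k, ‖(v (k + 1)).1‖ < ‖(v (k + 1)).2‖ := by
    intro k
    induction k with
    | zero => simp [hvs, hv0]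
    | succ k ih =>
      rw [hvs (k + 1)]
      set x := (v (k + 1)).1
      set y := (v (k + 1)).2
      have hy : 0 < ‖y‖ := lt_of_le_of_lt (norm_nonneg _) ih
      have h1 : ‖s * y‖ ≤ ‖x + s * y‖ + ‖x‖ := by
        have := norm_sub_le (x + s * y) x
        rwa [add_sub_cancel_left] at this
      have h2 : ‖s * y‖ = ‖s‖ * ‖y‖ := norm_mul _ _
      have h3 : 2 * ‖y‖ < ‖s‖ * ‖y‖ := mul_lt_mul_of_pos_right hs hy
      show ‖-y‖ < ‖x + s * y‖
      rw [norm_neg]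
      linarith
  -- if `S^k = 1` then `S` is a scalar
  intro hSk
  obtain ⟨m, rfl⟩ := Nat.exists_eq_add_one_of_ne_zero hk
  have hyne : (v (m + 1)).2 ≠ 0 := fun h => by
    have := hgrow m
    rw [h, norm_zero] at this
    exact absurd this (not_lt.mpr (norm_nonneg _))
  have hSk' : (v (m + 1)).1 • (1 : Matrix (Fin 2) (Fin 2) ℂ) + (v (m + 1)).2 • S = 1 := by
    have h := hSk
    rw [hpow] at h
    exact h
  set x := (v (m + 1)).1
  set y := (v (m + 1)).2
  set c : ℂ := (1 - x) / y with hc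
  clear_value x y c
  have hSc : S = c • (1 : Matrix (Fin 2) (Fin 2) ℂ) := by
    have h1 : y • S = (1 - x) • (1 : Matrix (Fin 2) (Fin 2) ℂ) := by
      rw [sub_smul, one_smul]
      exact eq_sub_of_add_eq' hSk'
    calc S = y⁻¹ • (y • S) := by rw [inv_smul_smul₀ hyne]
      _ = c • 1 := by rw [h1, smul_smul, hc, div_eq_inv_mul]
  -- the scalar `c` satisfies `c² = s c − 1` and `c^(m+1) = 1`
  have hcc : c * c = s * c - 1 := by
    have := congr_fun (congr_fun hS 0) 0
    simpa [hSc, Matrix.smul_apply, Matrix.one_apply, Matrix.sub_apply, smul_smul] using this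
  have hc0 : c ≠ 0 := by
    rintro h0
    rw [h0] at hcc
    norm_num at hcc
  have hck : c ^ (m + 1) = 1 := by
    have := congr_fun (congr_fun hSk 0) 0
    rw [hSc, smul_pow, one_pow, Matrix.smul_apply, Matrix.one_apply_eq, smul_eq_mul, mul_one] at this
    exact this
  have hnorm : ‖c‖ = 1 := Complex.norm_eq_one_of_pow_eq_one hck (Nat.add_one_ne_zero m)
  have hsc : s * c = c * c + 1 := by rw [hcc]; ring
  have hs' : s = c + c⁻¹ := by
    calc s = s * c * c⁻¹ := by rw [mul_assoc, mul_inv_cancel₀ hc0, mul_one]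
      _ = (c * c + 1) * c⁻¹ := by rw [hsc]
      _ = c + c⁻¹ := by rw [add_mul, mul_assoc, mul_inv_cancel₀ hc0, mul_one, one_mul]
  have : ‖s‖ ≤ 2 := by
    rw [hs']
    calc ‖c + c⁻¹‖ ≤ ‖c‖ + ‖c⁻¹‖ := norm_add_le _ _
      _ = 2 := by rw [norm_inv, hnorm]; norm_num
  linarith

/-! ### §4 The congruence: a power `≡ 1 (mod n)` integrally -/

/-- **A power `≡ 1 (mod n)`**: an integral `2 × 2` matrix `G` over `𝓞_F` of determinant `1` has, for every `n ≠ 0`, a positive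
power `G^o` which is `≡ 1 (mod n)` integrally, together with `(adj G)^o` (the same power of its inverse) — the image of `G` in the
finite group `GL₂(𝓞_F/(n))` has finite order. [cite: PlatonovRapinchuk1994, §4.1] -/
theorem exists_pow_isCongruentOneMod (F : Type) [Field F] [NumberField F] (G : Matrix (Fin 2) (Fin 2) (𝓞 F))
    (hdet : G.det = 1) {n : ℕ} (hn : n ≠ 0) :
    ∃ o : ℕ, 0 < o ∧ IsCongruentOneMod n ((G ^ o).map (algebraMap (𝓞 F) F)) ∧
      IsCongruentOneMod n ((G.adjugate ^ o).map (algebraMap (𝓞 F) F)) := by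
  classical
  set I : Ideal (𝓞 F) := Ideal.span {(n : 𝓞 F)} with hI
  have hIne : I ≠ ⊥ := by
    rw [hI, Ne, Ideal.span_singleton_eq_bot]
    exact_mod_cast hn
  haveI : Finite (𝓞 F ⧸ I) := Ideal.finiteQuotientOfFreeOfNeBot I hIne
  set π : 𝓞 F →+* 𝓞 F ⧸ I := Ideal.Quotient.mk I with hπ
  -- the image of `G` is a unit of the finite monoid `M₂(𝓞_F/(n))`
  have hdetbar : (π.mapMatrix G).det = 1 := by
    rw [← RingHom.map_det, hdet, map_one]
  let u : (Matrix (Fin 2) (Fin 2) (𝓞 F ⧸ I))ˣ :=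
    ⟨π.mapMatrix G, (π.mapMatrix G).adjugate, by rw [Matrix.mul_adjugate, hdetbar, one_smul],
      by rw [Matrix.adjugate_mul, hdetbar, one_smul]⟩
  obtain ⟨o, ho, huo⟩ := (isOfFinOrder_of_finite u).exists_pow_eq_one
  have hGo : π.mapMatrix (G ^ o) = 1 := by
    rw [map_pow]
    have := congrArg Units.val huo
    rwa [Units.val_pow_eq_pow_val, Units.val_one] at this
  have hGo' : π.mapMatrix (G.adjugate ^ o) = 1 := by
    rw [map_pow, RingHom.map_adjugate]
    have := congrArg Units.val (show u⁻¹ ^ o = 1 by rw [inv_pow, huo, inv_one])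
    rwa [Units.val_pow_eq_pow_val, Units.val_one] at this
  -- reading `≡ 1 (mod n)` integrally off the quotient
  have hcong : ∀ M : Matrix (Fin 2) (Fin 2) (𝓞 F), π.mapMatrix M = 1 →
      IsCongruentOneMod n (M.map (algebraMap (𝓞 F) F)) := by
    intro M hM
    have hentry : ∀ i j, ∃ b : 𝓞 F, (M - 1) i j = (n : 𝓞 F) * b := by
      intro i j
      have hij : π ((M - 1) i j) = 0 := by
        have := congr_fun (congr_fun hM i) j
        rw [RingHom.mapMatrix_apply, Matrix.map_apply] at this
        rw [Matrix.sub_apply, map_sub, this, Matrix.one_apply, Matrix.one_apply]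
        split_ifs <;> simp
      rw [hπ, Ideal.Quotient.eq_zero_iff_mem, hI, Ideal.mem_span_singleton] at hij
      exact hij
    choose b hb using hentry
    refine ⟨Matrix.of fun i j => b i j, ?_⟩
    have hM' : M = 1 + n • Matrix.of fun i j => b i j := by
      ext i j
      have := hb i j
      rw [Matrix.sub_apply] at this
      rw [Matrix.add_apply, Matrix.smul_apply, Matrix.of_apply, nsmul_eq_mul, ← this]
      ring
    conv_lhs => rw [hM']
    rw [← RingHom.mapMatrix_apply, map_add, map_one, map_nsmul, RingHom.mapMatrix_apply]
  exact ⟨o, ho, hcong _ hGo, hcong _ hGo'⟩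

/-! ### §5 The organ -/

/-- **ONE ELLIPTIC–HYPERBOLIC GENERATOR ⇒ INFINITELY MANY `ι₁`-BOUNDED ELEMENTS OF EVERY `Γ_J(n)`** (organ NOREC-A, tail; line L5
of crux hLiu418).  Let `F` be a CM field, `J ∈ M₂(F)`, `g ∈ U(J)(F⁺)` (★ `unitaryGroup` for the complex conjugation `c` of `F`)
INTEGRAL (`G ∈ M₂(𝓞_F)` maps to `g`), of determinant `1`, with `c`-fixed trace `t`, ELLIPTIC at the complex embedding `ι₁`
(`‖ι₁ t‖ < 2`) and HYPERBOLIC at `σ` (`‖σ t‖ > 2`).  Then for every `n ≠ 0` there is a bound `C` such that INFINITELY many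
`γ` in the principal congruence subgroup `Γ_J(n)` (★ `principalCongruenceSubgroup c J n`: `γ ∈ U(J)`, `γ ≡ 1`, `γ⁻¹ ≡ 1 (mod n)`
integrally) have ALL entries of `ι₁`-norm `≤ C` — namely the powers `g^{ok}`, `k ∈ ℕ`, for the order `o` of `g` modulo `n`.
(So `Γ_J(n)^{ι₁}` is NOT properly discrete; with ★ `UnitaryShimuraCurveRecordDiscrete` this refutes a record system for a
fake-signature form.)  The statement is the elementary core of «an irreducible lattice has non-discrete projections»
([Margulis1991] Ch. II §6 Thm. (6.7)(a)) for the torus `F⁺[g]^× ∩ U(J)`, with congruence subgroups as in [PlatonovRapinchuk1994] §4.1.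
[cite: Margulis1991, Ch. II §6 Thm. (6.7)(a)] [cite: PlatonovRapinchuk1994, §4.1] -/
theorem infinite_setOf_mem_principalCongruenceSubgroup_norm_le_of_generator
    (F : Type) [Field F] [NumberField F] [IsCMField F] (ι₁ σ : F →+* ℂ) (J : Matrix (Fin 2) (Fin 2) F)
    (g : GL (Fin 2) F)
    (hgU : g ∈ unitaryGroup ((IsCMField.complexConj F : F ≃ₐ[↥(maximalRealSubfield F)] F) : F →+* F) J)
    (G : Matrix (Fin 2) (Fin 2) (𝓞 F)) (hG : G.map (algebraMap (𝓞 F) F) = (g : Matrix (Fin 2) (Fin 2) F))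
    (hdet : (g : Matrix (Fin 2) (Fin 2) F).det = 1)
    (htr : IsCMField.complexConj F (g : Matrix (Fin 2) (Fin 2) F).trace = (g : Matrix (Fin 2) (Fin 2) F).trace)
    (hell : ‖ι₁ (g : Matrix (Fin 2) (Fin 2) F).trace‖ < 2) (hhyp : 2 < ‖σ (g : Matrix (Fin 2) (Fin 2) F).trace‖)
    {n : ℕ} (hn : n ≠ 0) :
    ∃ C : ℝ, {γ : GL (Fin 2) F |
      γ ∈ principalCongruenceSubgroup ((IsCMField.complexConj F : F ≃ₐ[↥(maximalRealSubfield F)] F) : F →+* F) J n ∧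
        ∀ i j, ‖ι₁ ((γ : Matrix (Fin 2) (Fin 2) F) i j)‖ ≤ C}.Infinite := by
  classical
  set A : Matrix (Fin 2) (Fin 2) F := (g : Matrix (Fin 2) (Fin 2) F) with hA
  set t : F := A.trace with ht
  -- Cayley–Hamilton
  have hA2 : A * A = t • A - 1 := by
    rw [mul_self_eq_trace_smul_sub_det_smul, hdet, one_smul]
  have hmap2 : ∀ φ : F →+* ℂ, A.map φ * A.map φ = φ t • A.map φ - 1 := by
    intro φ
    have := congrArg (fun M : Matrix (Fin 2) (Fin 2) F => M.map φ) hA2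
    rw [Matrix.map_mul] at this
    rw [this]
    ext i j
    simp [Matrix.map_apply, Matrix.sub_apply, Matrix.smul_apply, Matrix.one_apply, apply_ite φ]
  -- the elliptic place `ι₁`: the trace is real of absolute value `< 2`, powers are bounded
  have hreal : ((ι₁ t).re : ℂ) = ι₁ t := by
    rw [← Complex.conj_eq_iff_re, ← IsCMField.complexEmbedding_complexConj F ι₁ t]
    exact congrArg ι₁ htr
  have hs : |(ι₁ t).re| < 2 := by
    have : ‖((ι₁ t).re : ℂ)‖ < 2 := by rw [hreal]; exact hell
    rwa [Complex.norm_real, Real.norm_eq_abs] at this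
  have hB : A.map ι₁ * A.map ι₁ = ((ι₁ t).re : ℂ) • A.map ι₁ - 1 := by rw [hreal]; exact hmap2 ι₁
  obtain ⟨C, hC⟩ := exists_forall_pow_norm_apply_le_of_mul_self (A.map ι₁) (ι₁ t).re hs hB
  -- the hyperbolic place `σ`: `g` has infinite order
  have hninf : ¬IsOfFinOrder g := by
    intro hfin
    obtain ⟨k, hk, hgk⟩ := hfin.exists_pow_eq_one
    have hAk : A ^ k = 1 := by
      have := congrArg (fun u : GL (Fin 2) F => (u : Matrix (Fin 2) (Fin 2) F)) hgk
      simpa only [Units.val_pow_eq_pow_val, Units.val_one] using this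
    have hSk : (A.map σ) ^ k = 1 := by
      rw [← Matrix.map_pow, hAk, Matrix.map_one σ (map_zero σ) (map_one σ)]
    exact pow_ne_one_of_mul_self (A.map σ) (σ t) hhyp (hmap2 σ) hk.ne' hSk
  -- the congruence: a positive power `o` with `g^o ≡ 1`, `(g^o)⁻¹ ≡ 1 (mod n)`
  have hGdet : G.det = 1 := by
    apply RingOfIntegers.coe_injective
    rw [RingHom.map_det, RingHom.mapMatrix_apply, hG, hdet, map_one]
  obtain ⟨o, ho, hcong, hcong'⟩ := exists_pow_isCongruentOneMod F G hGdet hn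
  -- the inverse of `g` is the adjugate
  have hginv : ((g⁻¹ : GL (Fin 2) F) : Matrix (Fin 2) (Fin 2) F) = A.adjugate :=
    Units.inv_eq_of_mul_eq_one_right (by rw [← hA, Matrix.mul_adjugate, hdet, one_smul])
  have hadj : A.adjugate = G.adjugate.map (algebraMap (𝓞 F) F) := by
    rw [← RingHom.mapMatrix_apply, RingHom.map_adjugate, RingHom.mapMatrix_apply, hG]
  -- powers of `≡ 1 (mod n)` matrices are `≡ 1 (mod n)`
  have hpowcong : ∀ (M : Matrix (Fin 2) (Fin 2) F), IsCongruentOneMod n M → ∀ k : ℕ, IsCongruentOneMod n (M ^ k) := by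
    intro M hM k
    induction k with
    | zero => rw [pow_zero]; exact isCongruentOneMod_one n
    | succ k ih => rw [pow_succ]; exact ih.mul hM
  -- the family `k ↦ (g^o)^k`
  have hinj : Function.Injective fun k : ℕ => (g ^ o) ^ k := by
    rw [injective_pow_iff_not_isOfFinOrder]
    intro hfin
    obtain ⟨m, hm, hgm⟩ := hfin.exists_pow_eq_one
    exact hninf (isOfFinOrder_iff_pow_eq_one.mpr ⟨o * m, Nat.mul_pos ho hm, by rw [pow_mul, hgm]⟩)
  refine ⟨C, Set.infinite_of_injective_forall_mem hinj fun k => ⟨⟨?_, ?_, ?_⟩, ?_⟩⟩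
  · -- in `U(J)`
    exact Subgroup.pow_mem _ (Subgroup.pow_mem _ hgU o) k
  · -- `≡ 1 (mod n)`
    have hval : (((g ^ o) ^ k : GL (Fin 2) F) : Matrix (Fin 2) (Fin 2) F) = ((G ^ o).map (algebraMap (𝓞 F) F)) ^ k := by
      rw [Units.val_pow_eq_pow_val, Units.val_pow_eq_pow_val, Matrix.map_pow, hG]
    rw [hval]
    exact hpowcong _ hcong k
  · -- the inverse `≡ 1 (mod n)`
    have hval : ((((g ^ o) ^ k)⁻¹ : GL (Fin 2) F) : Matrix (Fin 2) (Fin 2) F) =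
        ((G.adjugate ^ o).map (algebraMap (𝓞 F) F)) ^ k := by
      rw [← inv_pow, ← inv_pow, Units.val_pow_eq_pow_val, Units.val_pow_eq_pow_val, hginv, hadj, Matrix.map_pow]
    rw [hval]
    exact hpowcong _ hcong' k
  · -- `ι₁`-bounded
    intro i j
    have hval : (((g ^ o) ^ k : GL (Fin 2) F) : Matrix (Fin 2) (Fin 2) F) = A ^ (o * k) := by
      rw [Units.val_pow_eq_pow_val, Units.val_pow_eq_pow_val, ← pow_mul]
    have := hC (o * k) i j
    rwa [← Matrix.map_pow, Matrix.map_apply, ← hval] at this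

end Literature.NumberTheory.Automorphic.UnitaryGroup

end
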